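import Mathlib
import Literature.Computability.AlgebraicComplexity.DepthThreeRankBound
import Summits.ValiantsHypothesis.ValiantsHypothesis.Theorems.MonotoneRestorationOrbitRestorationQPHomogTools
import Summits.ValiantsHypothesis.ValiantsHypothesis.Theorems.MonotoneRestorationOrbitRestorationQPRankDistance
import HarnessLib

/-!
# The rank bound for minimal vanishing families of affine products (ORBIT currency)

Route MonotoneRestoration, crux `OrbitRestorationQP` (stmt-ValiantsHypothesis-18293), line `depth-three-rung`, registered stub
`stub_sigmaPiSigmaKValue` (A_k).  Namespace `Summit.ValiantsHypothesis.ValiantsHypothesis.Theorems.RankBoundBridge`.  Route-independent.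

Layer L1′ (b) of the formalisation plan of `Cruxes/OrbitRestorationQP/Lines/depth-three-rung-stubA-bounded-fanin.md` (§1 "Consequence
used below", §8 L1): **from the named Saxena–Seshadhri rank bound `depthThree_rankBound` (homogeneous, simple, minimal `ΣΠΣ(k,d)`
identities) to the affine statement the structure theorem consumes** — in a MINIMAL vanishing family `Σ_i a_i Π L_i = 0` of `m ≥ 3`
scaled products of at most `D` polynomials of degree `1` (normalised: associated factors are equal), the span of the gcd-free factors
`⋃_i (L_i − G)`, `G = ⋀_i L_i`, has dimension `< 3m²(⌊log₂ 2D⌋ + 1)` (`finrank_simplePart_lt`); consequently every pairwise rank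
distance `Δ(L_i, L_j)` obeys the same bound (`rdist_lt_of_minVanishing`).  Proof: divide by `Π G`; homogenise with `z = X none` and pad
every term to length `d = max_i |L_i − G|` (`HomogTools.hterm`); the homogenised family vanishes (substitute `X_x ↦ X_(some x)/z` in
the fraction field), is minimal (dehomogenise a vanishing sub-sum) and simple (a common linear factor is `z` — impossible at a term
of maximal length — or comes from ONE normalised factor common to all `L_i − G`, contradicting the gcd); the rank of the homogenised
family dominates the span of the gcd-free factors (dehomogenisation is linear).

Everything is proved modulo the named fact `depthThree_rankBound`, taken BY NAME as a hypothesis.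
[cite: SaxenaSeshadhri2013, Theorem 5; KarninShpilka2009, §3]
-/

noncomputable section

open MvPolynomial Literature.Computability.MetaComplexity Literature.Computability.AlgebraicComplexity

-- `Summit.ValiantsHypothesis.ValiantsHypothesis.…` is the tree's single-conjunct layout (Sub = Summit).
set_option linter.dupNamespace false

namespace Summit.ValiantsHypothesis.ValiantsHypothesis.Theorems

namespace RankBoundBridge

open HomogTools RankDistance

universe u

variable {K : Type} [Field K] {τ : Type} [Fintype τ] [DecidableEq τ]

/-! ### Primes of degree one -/

omit [Fintype τ] [DecidableEq τ] in
/-- Over a field, a polynomial of total degree `1` is prime. [folklore] -/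
theorem prime_of_totalDegree_eq_one {q : MvPolynomial τ K} (hq : q.totalDegree = 1) : Prime q := by
  refine UniqueFactorizationMonoid.irreducible_iff_prime.1
    (MvPolynomial.irreducible_of_totalDegree_eq_one hq fun x hx => ?_)
  by_cases hx0 : x = 0
  · subst hx0
    have hq0 : q = 0 := MvPolynomial.ext _ _ fun i => by simpa using hx i
    rw [hq0, totalDegree_zero] at hq
    exact absurd hq zero_ne_one
  · exact isUnit_iff_ne_zero.2 hx0

omit [Fintype τ] [DecidableEq τ] in
/-- A polynomial associated to `1` has total degree `0`. [folklore] -/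
theorem totalDegree_eq_zero_of_isUnit {q : MvPolynomial τ K} (hq : IsUnit q) : q.totalDegree = 0 := by
  obtain ⟨r, -, hr⟩ := MvPolynomial.isUnit_iff_eq_C_of_isReduced.1 hq
  rw [hr, totalDegree_C]

/-! ### The main bridge -/

/-- **RANK BOUND FOR MINIMAL VANISHING FAMILIES OF AFFINE PRODUCTS.**  Let `Σ_{i : ι} a_i · Π L_i = 0` (`|ι| ≥ 3`, all `a_i ≠ 0`,
every member of every `L_i` of total degree `1`, `|L_i| ≤ D`, associated members equal) be MINIMAL (no nonempty proper sub-sum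
vanishes).  Then, granting the Saxena–Seshadhri rank bound, the gcd-free factors `⋃_i (L_i − ⋀_j L_j)` span a space of dimension
`< 3|ι|²(⌊log₂ 2D⌋ + 1)`. [cite: SaxenaSeshadhri2013, Theorem 5] -/
theorem finrank_simplePart_lt (hRB : depthThree_rankBound) [DecidableEq (MvPolynomial τ K)] {ι : Type u} [Fintype ι]
    [DecidableEq ι] (a : ι → K) (L : ι → Multiset (MvPolynomial τ K)) (D : ℕ)
    (ha : ∀ i, a i ≠ 0) (hdeg : ∀ i, ∀ q ∈ L i, q.totalDegree = 1) (hD : ∀ i, Multiset.card (L i) ≤ D)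
    (hassoc : ∀ i j, ∀ q ∈ L i, ∀ q' ∈ L j, Associated q q' → q = q')
    (hvan : ∑ i, C (a i) * (L i).prod = 0)
    (hmin : ∀ I : Finset ι, I.Nonempty → I ≠ Finset.univ → ∑ i ∈ I, C (a i) * (L i).prod ≠ 0)
    (hm : 3 ≤ Fintype.card ι) (hne : (Finset.univ : Finset ι).Nonempty) :
    Module.finrank K (Submodule.span K (simplePart L Finset.univ hne)) <
      3 * Fintype.card ι ^ 2 * (Nat.log 2 (2 * D) + 1) := by
  classical
  -- the gcd and the gcd-free parts
  set G : Multiset (MvPolynomial τ K) := Finset.univ.inf' hne L with hG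
  set M : ι → Multiset (MvPolynomial τ K) := fun i => L i - G with hM
  have hGle : ∀ i, G ≤ L i := fun i => Finset.inf'_le L (Finset.mem_univ i)
  have hLM : ∀ i, L i = G + M i := fun i => (add_tsub_cancel_of_le (hGle i)).symm
  have hMsub : ∀ i, ∀ q ∈ M i, q ∈ L i := fun i q hq => Multiset.mem_of_le (Multiset.sub_le_self _ _) hq
  have hMdeg : ∀ i, ∀ q ∈ M i, q.totalDegree = 1 := fun i q hq => hdeg i q (hMsub i q hq)
  have hMD : ∀ i, Multiset.card (M i) ≤ D := fun i => (Multiset.card_le_card (Multiset.sub_le_self _ _)).trans (hD i)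
  -- `Π G ≠ 0`
  have hG0 : G.prod ≠ 0 := by
    rw [Ne, Multiset.prod_eq_zero_iff]
    intro h0
    obtain ⟨i, -⟩ := id hne
    have := hdeg i 0 (Multiset.mem_of_le (hGle i) h0)
    rw [totalDegree_zero] at this
    exact zero_ne_one this
  have hprod : ∀ i, (L i).prod = G.prod * (M i).prod := fun i => by
    conv_lhs => rw [hLM i]
    rw [Multiset.prod_add]
  -- the reduced family is vanishing and minimal
  have hsumI : ∀ I : Finset ι, ∑ i ∈ I, C (a i) * (L i).prod = G.prod * ∑ i ∈ I, C (a i) * (M i).prod := by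
    intro I
    rw [Finset.mul_sum]
    exact Finset.sum_congr rfl fun i _ => by rw [hprod]; ring
  have hvanM : ∑ i, C (a i) * (M i).prod = 0 := by
    have h := hvan
    rw [hsumI] at h
    exact (mul_eq_zero.1 h).resolve_left hG0
  have hminM : ∀ I : Finset ι, I.Nonempty → I ≠ Finset.univ → ∑ i ∈ I, C (a i) * (M i).prod ≠ 0 := by
    intro I hI hIu h0
    exact hmin I hI hIu (by rw [hsumI, h0, mul_zero])
  -- the common length `d`
  set d : ℕ := Finset.univ.sup fun i => Multiset.card (M i) with hd
  have hMd : ∀ i, Multiset.card (M i) ≤ d := fun i => Finset.le_sup (f := fun i => Multiset.card (M i)) (Finset.mem_univ i)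
  have hdD : d ≤ D := Finset.sup_le fun i _ => hMD i
  have hbound_mono : 3 * Fintype.card ι ^ 2 * (Nat.log 2 (2 * d) + 1) ≤ 3 * Fintype.card ι ^ 2 * (Nat.log 2 (2 * D) + 1) :=
    Nat.mul_le_mul_left _ (Nat.add_le_add_right (Nat.log_mono_right (Nat.mul_le_mul_left 2 hdD)) 1)
  by_cases hd0 : d = 0
  · -- all gcd-free parts are empty
    have hempty : simplePart L Finset.univ hne = ∅ := by
      ext q
      simp only [simplePart, Set.mem_setOf_eq, Set.mem_empty_iff_false, iff_false, not_exists, not_and]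
      intro i _ hq
      have h1 : Multiset.card (M i) = 0 := by have := hMd i; omega
      rw [Multiset.card_eq_zero] at h1
      have : q ∈ M i := hq
      rw [h1] at this
      exact Multiset.notMem_zero q this
    rw [hempty, Submodule.span_empty, finrank_bot]
    have : 1 ≤ Fintype.card ι ^ 2 := Nat.one_le_pow _ _ (by omega)
    nlinarith
  have hd1 : 1 ≤ d := Nat.one_le_iff_ne_zero.2 hd0
  -- the homogenised formula
  set t : ι → List (AffineForm (Option τ) K) := fun i => hterm (a i) d (M i) with ht
  set l : List ι := (Finset.univ : Finset ι).toList with hl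
  set F : SigmaPiSigma (Option τ) K := l.map t with hF
  have hlnd : l.Nodup := Finset.nodup_toList _
  have hFlen : F.length = Fintype.card ι := by rw [hF, List.length_map, hl, Finset.length_toList, Finset.card_univ]
  have hmemF : ∀ s ∈ F, ∃ i, s = t i := fun s hs => by
    obtain ⟨i, -, rfl⟩ := List.mem_map.1 hs
    exact ⟨i, rfl⟩
  -- lengths and homogeneity
  have hlen : ∀ s ∈ F, s.length = d := fun s hs => by
    obtain ⟨i, rfl⟩ := hmemF s hs
    exact length_hterm (a i) (hMd i)
  have hhom : SigmaPiSigmaIsHomogeneous F := fun s hs ℓ hℓ => by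
    obtain ⟨i, rfl⟩ := hmemF s hs
    exact hterm_homogeneous (a i) d (M i) ℓ hℓ
  -- dehomogenised terms
  have hdeh : ∀ i, dehom (SigmaPiSigma.termPoly (t i)) = C (a i) * (M i).prod := fun i =>
    dehom_termPoly_hterm (a i) (hMd i) hd1 fun q hq => (hMdeg i q hq).le
  -- sub-sums indexed by sublists
  have hsub_sum : ∀ l' : List ι, l'.Nodup →
      dehom (SigmaPiSigma.toPoly (l'.map t)) = ∑ i ∈ l'.toFinset, C (a i) * (M i).prod := by
    intro l' hl'
    rw [SigmaPiSigma.toPoly, List.map_map, map_list_sum, List.map_map, List.sum_toFinset _ hl']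
    exact congrArg List.sum (List.map_congr_left fun i _ => hdeh i)
  -- minimality
  have hminF : SigmaPiSigmaIsMinimal F := by
    intro F' hsub hpos hlt h0
    obtain ⟨l', hl', rfl⟩ := List.sublist_map_iff.1 hsub
    have hnd' : l'.Nodup := hl'.nodup hlnd
    have hI : (∑ i ∈ l'.toFinset, C (a i) * (M i).prod) = 0 := by
      rw [← hsub_sum l' hnd', h0, map_zero]
    refine hminM l'.toFinset ?_ ?_ hI
    · rw [List.toFinset_nonempty_iff]
      rintro rfl
      simp at hpos
    · intro hu
      have h1 : l'.toFinset.card = l'.length := List.toFinset_card_of_nodup hnd'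
      rw [hu, Finset.card_univ] at h1
      rw [List.length_map, hFlen] at hlt
      omega
  -- vanishing, via the substitution `X_x ↦ X_(some x) / z` in the fraction field
  have hF0 : SigmaPiSigma.toPoly F = 0 := by
    let E := FractionRing (MvPolynomial (Option τ) K)
    let φ : MvPolynomial (Option τ) K →+* E := algebraMap _ E
    have hφ : Function.Injective φ := IsFractionRing.injective _ _
    have hz : φ (X none) ≠ 0 := (map_ne_zero_iff φ hφ).2 (X_ne_zero _)
    let θ : MvPolynomial τ K →ₐ[K] E := aeval fun x => φ (X (some x)) / φ (X none)
    have hθC : ∀ c : K, θ (C c) = φ (C c) := fun c => by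
      rw [aeval_C, IsScalarTower.algebraMap_apply K (MvPolynomial (Option τ) K) E, MvPolynomial.algebraMap_eq]
    have hθ1 : ∀ q : MvPolynomial τ K, q.totalDegree ≤ 1 →
        θ q = φ (AffineForm.toPoly (hat q)) / φ (X none) := by
      intro q hq
      conv_lhs => rw [eq_C_add_sum_of_totalDegree_le_one hq]
      rw [toPoly_hat, map_add, map_sum, map_add, map_sum, add_div, Finset.sum_div, hθC, map_mul,
        mul_div_cancel_right₀ _ hz, add_comm]
      congr 1
      refine Finset.sum_congr rfl fun x _ => ?_
      rw [map_mul, hθC, aeval_X, map_mul, mul_div_assoc]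
    have hθT : ∀ i, φ (SigmaPiSigma.termPoly (t i)) = φ (X none) ^ d * θ (C (a i) * (M i).prod) := by
      intro i
      rw [termPoly_hterm (a i) (hMd i) hd1, map_mul θ, hθC, map_multiset_prod, map_mul φ, map_mul φ, map_pow,
        map_multiset_prod, Multiset.map_map]
      have hmap : (M i).map θ = (M i).map fun q => φ (AffineForm.toPoly (hat q)) * (φ (X none))⁻¹ :=
        Multiset.map_congr rfl fun q hq => by rw [hθ1 q (hMdeg i q hq).le, div_eq_mul_inv]
      rw [hmap, Multiset.prod_map_mul, Multiset.map_const', Multiset.prod_replicate]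
      have hsplit : φ (X none) ^ d = φ (X none) ^ (d - Multiset.card (M i)) * φ (X none) ^ Multiset.card (M i) := by
        rw [← pow_add, Nat.sub_add_cancel (hMd i)]
      rw [hsplit]
      have hzk : φ (X none) ^ Multiset.card (M i) * (φ (X none))⁻¹ ^ Multiset.card (M i) = 1 := by
        rw [← mul_pow, mul_inv_cancel₀ hz, one_pow]
      have : (Multiset.map (⇑φ ∘ fun ℓ => AffineForm.toPoly (hat ℓ)) (M i)) =
          Multiset.map (fun q => φ (AffineForm.toPoly (hat q))) (M i) := rfl
      rw [this]
      linear_combination (-(φ (C (a i)) * φ (X none) ^ (d - Multiset.card (M i)) *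
        (Multiset.map (fun q => φ (AffineForm.toPoly (hat q))) (M i)).prod)) * hzk
    apply hφ
    rw [map_zero, SigmaPiSigma.toPoly, map_list_sum, List.map_map]
    have h1 : (List.map (⇑φ ∘ SigmaPiSigma.termPoly) F) = l.map fun i => φ (X none) ^ d * θ (C (a i) * (M i).prod) := by
      rw [hF, List.map_map]
      exact List.map_congr_left fun i _ => hθT i
    rw [h1, hl, Finset.sum_map_toList, ← Finset.mul_sum, ← map_sum, hvanM, map_zero, mul_zero]
  -- simplicity
  have hsimple : SigmaPiSigmaIsSimple F := by
    intro lam hlam hdiv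
    have hp1 : (AffineForm.toPoly lam).totalDegree = 1 := totalDegree_toPoly_eq_one hlam
    have hp : Prime (AffineForm.toPoly lam) := prime_of_totalDegree_eq_one hp1
    have hzirr : Irreducible (X none : MvPolynomial (Option τ) K) :=
      (prime_of_totalDegree_eq_one (totalDegree_X (R := K) none)).irreducible
    -- what a prime dividing a term looks like
    have hcase : ∀ i, (∃ q ∈ M i, Associated (AffineForm.toPoly lam) (AffineForm.toPoly (hat q))) ∨
        (Associated (AffineForm.toPoly lam) (X none) ∧ Multiset.card (M i) < d) := by
      intro i
      have h1 := hdiv (t i) (List.mem_map.2 ⟨i, by rw [hl]; exact Finset.mem_toList.2 (Finset.mem_univ i), rfl⟩)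
      rw [termPoly_hterm (a i) (hMd i) hd1] at h1
      rcases hp.dvd_or_dvd h1 with h2 | h2
      · exact absurd (isUnit_of_dvd_unit h2 ((isUnit_iff_ne_zero.2 (ha i)).map C)) hp.not_unit
      rcases hp.dvd_or_dvd h2 with h3 | h3
      · right
        have hk : d - Multiset.card (M i) ≠ 0 := by
          rintro hk
          rw [hk, pow_zero] at h3
          exact hp.not_unit (isUnit_of_dvd_one h3)
        exact ⟨hp.irreducible.associated_of_dvd hzirr (hp.dvd_of_dvd_pow h3), by omega⟩
      · left
        obtain ⟨p', hp', hdvd⟩ := hp.exists_mem_multiset_dvd h3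
        obtain ⟨q, hq, rfl⟩ := Multiset.mem_map.1 hp'
        have hqirr : Irreducible (AffineForm.toPoly (hat q)) :=
          (prime_of_totalDegree_eq_one (totalDegree_toPoly_hat (hMdeg i q hq))).irreducible
        exact ⟨q, hq, hp.irreducible.associated_of_dvd hqirr hdvd⟩
    -- a term of maximal length rules out `z`
    obtain ⟨i₀, -, hi₀⟩ := Finset.exists_mem_eq_sup Finset.univ hne fun i => Multiset.card (M i)
    have hnotz : ¬ Associated (AffineForm.toPoly lam) (X none) := by
      intro hz'
      rcases hcase i₀ with ⟨q, hq, hq'⟩ | ⟨-, hlt⟩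
      · have h1 : Associated (X none : MvPolynomial (Option τ) K) (AffineForm.toPoly (hat q)) := hz'.symm.trans hq'
        have h2 := h1.map (dehom (K := K) (τ := τ))
        rw [dehom_X_none, dehom_toPoly_hat (hMdeg i₀ q hq).le] at h2
        have h3 := totalDegree_eq_zero_of_isUnit ((associated_one_iff_isUnit).1 h2.symm)
        rw [hMdeg i₀ q hq] at h3
        exact one_ne_zero h3
      · rw [hd, hi₀] at hlt
        exact lt_irrefl _ hlt
    have hcase' : ∀ i, ∃ q ∈ M i, Associated (AffineForm.toPoly lam) (AffineForm.toPoly (hat q)) := fun i => by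
      rcases hcase i with h | ⟨h, -⟩
      · exact h
      · exact absurd h hnotz
    choose q hqM hqass using hcase'
    -- all the `q i` coincide
    have hqeq : ∀ i j, q i = q j := by
      intro i j
      have h1 : Associated (AffineForm.toPoly (hat (q i))) (AffineForm.toPoly (hat (q j))) := (hqass i).symm.trans (hqass j)
      have h2 := h1.map (dehom (K := K) (τ := τ))
      rw [dehom_toPoly_hat (hMdeg i _ (hqM i)).le, dehom_toPoly_hat (hMdeg j _ (hqM j)).le] at h2
      exact hassoc i j _ (hMsub i _ (hqM i)) _ (hMsub j _ (hqM j)) h2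
    -- so `q i₀` lies in every `L i - G`: contradiction with the gcd
    obtain ⟨j, -, hj⟩ := Finset.exists_mem_eq_inf' hne fun l => (L l).count (q i₀)
    have hcount : G.count (q i₀) = (L j).count (q i₀) := by rw [hG, count_inf' L Finset.univ hne, hj]
    have hmem : q i₀ ∈ M j := by rw [hqeq i₀ j]; exact hqM j
    rw [← Multiset.count_pos, hM] at hmem
    simp only [Multiset.count_sub] at hmem
    omega
  -- the rank bound
  have hrank := hRB K (Option τ) F d (by rw [hFlen]; exact hm) hd1 hlen hhom hF0 hsimple hminF
  rw [hFlen] at hrank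
  refine lt_of_le_of_lt ?_ (lt_of_lt_of_le hrank hbound_mono)
  -- compare the two spans through dehomogenisation
  set SF : Set (MvPolynomial (Option τ) K) := {p | ∃ s ∈ F, ∃ ℓ ∈ s, p = AffineForm.toPoly ℓ} with hSF
  have hSFfin : SF.Finite := by
    refine Set.Finite.subset ((F.flatMap id).map AffineForm.toPoly).toFinset.finite_toSet ?_
    rintro p ⟨s, hs, ℓ, hℓ, rfl⟩
    simp only [List.coe_toFinset, Set.mem_setOf_eq, List.mem_map, List.mem_flatMap, id]
    exact ⟨ℓ, ⟨s, hs, hℓ⟩, rfl⟩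
  haveI : FiniteDimensional K (Submodule.span K SF) := FiniteDimensional.span_of_finite K hSFfin
  have hle : Submodule.span K (simplePart L Finset.univ hne) ≤
      (Submodule.span K SF).map (dehom (K := K) (τ := τ)).toLinearMap := by
    refine Submodule.span_le.2 ?_
    rintro p ⟨i, -, hp⟩
    have h1 : AffineForm.toPoly (hat p) ∈ Submodule.span K SF :=
      mem_span_of_mem_hterm (ha i) d hp SF fun x hx =>
        ⟨t i, List.mem_map.2 ⟨i, by rw [hl]; exact Finset.mem_toList.2 (Finset.mem_univ i), rfl⟩, x, hx, rfl⟩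
    exact ⟨AffineForm.toPoly (hat p), h1, dehom_toPoly_hat (hMdeg i p hp).le⟩
  calc Module.finrank K (Submodule.span K (simplePart L Finset.univ hne))
      ≤ Module.finrank K ((Submodule.span K SF).map (dehom (K := K) (τ := τ)).toLinearMap) := Submodule.finrank_mono hle
    _ ≤ Module.finrank K (Submodule.span K SF) := Submodule.finrank_map_le _ _
    _ = sigmaPiSigmaRank F := rfl

/-- **COROLLARY: the rank distance inside a minimal vanishing family.**  Under the hypotheses of `finrank_simplePart_lt`, every two
factor multisets are at rank distance `< 3|ι|²(⌊log₂ 2D⌋ + 1)`. [cite: SaxenaSeshadhri2013, Theorem 5; KarninShpilka2009, §3] -/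
theorem rdist_lt_of_minVanishing (hRB : depthThree_rankBound) [DecidableEq (MvPolynomial τ K)] {ι : Type u} [Fintype ι]
    [DecidableEq ι] (a : ι → K) (L : ι → Multiset (MvPolynomial τ K)) (D : ℕ)
    (ha : ∀ i, a i ≠ 0) (hdeg : ∀ i, ∀ q ∈ L i, q.totalDegree = 1) (hD : ∀ i, Multiset.card (L i) ≤ D)
    (hassoc : ∀ i j, ∀ q ∈ L i, ∀ q' ∈ L j, Associated q q' → q = q')
    (hvan : ∑ i, C (a i) * (L i).prod = 0)
    (hmin : ∀ I : Finset ι, I.Nonempty → I ≠ Finset.univ → ∑ i ∈ I, C (a i) * (L i).prod ≠ 0)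
    (hm : 3 ≤ Fintype.card ι) (i j : ι) :
    rdist (L i) (L j) < 3 * Fintype.card ι ^ 2 * (Nat.log 2 (2 * D) + 1) := by
  have hne : (Finset.univ : Finset ι).Nonempty := ⟨i, Finset.mem_univ i⟩
  exact lt_of_le_of_lt (rdist_le_finrank_simplePart L Finset.univ hne (Finset.mem_univ i) (Finset.mem_univ j))
    (finrank_simplePart_lt hRB a L D ha hdeg hD hassoc hvan hmin hm hne)

end RankBoundBridge

end Summit.ValiantsHypothesis.ValiantsHypothesis.Theorems

end
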